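import Summits.AtomisticToContinuum.HydrodynamicLimit.Theorems.MourreKoopmanChargesStressStrongMixingTwoTimeClustering
import Summits.AtomisticToContinuum.HydrodynamicLimit.Theorems.MourreKoopmanChargesStressStrongMixingObservableSpan
import HarnessLib

/-!
# `OneBodyCompleteness` · line `registered`, stub `stub_dynamicClusteringOneBody`: REDUCTION of the open dynamic core
# to Doyon's two hypotheses (mean-square continuity of the flow on the generators + continuous clustering)

Support file for the crux item stmt-AtomisticToContinuum-9583 (`OneBodyCompleteness`, route `MourreKoopmanCharges` of
`AtomisticToContinuum/HydrodynamicLimit`), line `registered` (`Cruxes/OneBodyCompleteness/Lines/birth.lean`, skeleton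
v6.2), registered stub `stub_dynamicClusteringOneBody` — the line's OPEN DYNAMIC CORE: below an activity threshold,
for every unit-diameter equilibrium flow `Φ`, every translation-invariant DLR state `G` of unit hard spheres at unit
inverse temperature and every admissible profile `g`, static clustering of the generators `S_g = {n_0,…,n_4, A_g}`
implies (i) `x ↦ Cov_G(a, (b ∘ Φ_t) ∘ τ_x) ∈ L¹(ℝ³)` for all `a, b ∈ S_g` and all `t`, and (ii) continuity at `t = 0`
of the space-integrated autocorrelations `C_b(t) = ∫ Cov_G(b, (b ∘ Φ_t) ∘ τ_x) dx`, `b ∈ S_g`.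

The stub is NOT proved here (nor refuted): (i) at `t ≠ 0` is space–time clustering of the dilute hard-sphere gas
under Alexander's dynamics, an ASSUMPTION in print (Spohn 1991 Part I §7.1; Doyon 2022 Def. 4.3–4.4, 4.8), and the
tree asserts no locality of any `InfiniteHardSphereFlow`.  What IS proved is the reduction of the registered
signature to the two hypotheses of Doyon 2022 Thm 4.11 (III), at the level of the flow structure:

* SANITY.  `C_b(0)` is the static form and (i) at `t = 0` is the static hypothesis (`Φ_0 = id` a.e.; sibling
  `cov_flow_zero_spatialShift`, `integrable_cov_flow_zero_spatialShift_iff`).  Under a.e. commutation of the flow with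
  the shifts (in the skeleton from `InfiniteHardSphereFlow.unique` via `equilibriumFlowShiftCovariant_of_unique`; NOT a
  hypothesis of the stub) the TIME-REVERSAL identity `Cov(a, (b ∘ Φ_{-t}) ∘ τ_x) = Cov(b, (a ∘ Φ_t) ∘ τ_{-x})`
  (`cov_flow_neg_spatialShift`) holds, so (i) for `t ≥ 0` gives (i) for all `t`
  (`integrable_cov_flow_spatialShift_of_nonneg`) and `C_b` is EVEN (`integral_cov_flow_neg_spatialShift`): the
  two-sided `ContinuousAt … 0` of the signature is equivalent to right continuity at `0`
  (`continuousAt_integral_cov_of_continuousWithinAt_Ici`).  No degenerate instance (`g = 0` is admissible, then all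
  is `0`; Gibbs states exist, `RuelleDiluteHardSphereGas_holds`; equilibrium flows are Alexander's named theorem).
* (ii) FROM MEAN-SQUARE CONTINUITY + CONTINUOUS CLUSTERING (Doyon 2022 Thm 4.11 (III): "by strong continuity the
  summand converges to zero pointwise; by uniform clustering on `t ∈ [-ε, ε]` it is bounded by a summable sequence;
  bounded convergence"): `|Cov(a, B₁ ∘ τ_x) - Cov(a, B₂ ∘ τ_x)| ≤ (Var a)^{1/2} ‖B₁ - B₂‖₂` uniformly in `x`
  (`abs_cov_comp_spatialShift_sub_le`), so `∫ (b ∘ Φ_t - b)² dG → 0` gives pointwise-in-`x` convergence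
  (`tendsto_cov_flow_spatialShift`); an integrable majorant off a ball for `t` near `0`, completed inside the ball by
  Cauchy–Schwarz and stationarity, gives `ContinuousAt C_b 0` (`continuousAt_integral_cov_flow_spatialShift`).
  Mean-square continuity need only hold for `t → 0⁺` (`tendsto_integral_sq_sub_flow_of_Ici`: stationarity and the
  a.e. group law give `‖b ∘ Φ_{-t} - b‖₂ = ‖b ∘ Φ_t - b‖₂`, no shift covariance needed).
* THE REGISTERED SIGNATURE FROM TWO NAMED INPUTS (`dynamicClusteringOneBody_of`, hypotheses verbatim):
  (D1) CONTINUOUS CLUSTERING of the generators under unit-diameter equilibrium flows in dilute unit-temperature DLR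
  states — for `a, b ∈ S_g` and `T`, an integrable majorant of `|Cov_G(a, (b ∘ Φ_t) ∘ τ_x)|` off a ball, uniform in
  `|t| ≤ T` (Doyon 2022 Def. 4.8 / Spohn 1991 Part I §7.1 — assumed in print: the open content);
  (D2) RIGHT MEAN-SQUARE CONTINUITY at `t = 0` of `t ↦ A_h ∘ Φ_t` in `L²(G)`, `h` continuous polynomially bounded
  (Doyon's strong continuity of `τ` on the GNS space; for Alexander's flow a consequence of the regularity of his
  solutions, Def. 4.8 (b) (i) — displacement bounds for the particles in `Λ(r)` over short time intervals, eventually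
  in `r`, so that finitely many particles visit a bounded region in bounded time — deliberately NOT a field of
  `InfiniteHardSphereFlow`, whose per-particle path regularity carries no uniformity over the infinitely many
  particles; so (D2) is not derivable from the structure axioms).
  Given (D1)–(D2): (i) by the sibling `integrable_cov_flow_spatialShift_of_decay`, (ii) by the bullet above.

References: B. Doyon, Comm. Math. Phys. 391 (2022), §4.1 Def. 4.3–4.4, §4.3 Def. 4.8, Thm 4.11 (III); H. Spohn,
*Large Scale Dynamics of Interacting Particles* (1991), Part I §7.1 (7.6), (7.14)–(7.15); R. Alexander, Comm. Math.
Phys. 49 (1976), Def. 4.8, Thm 5.2, Cor. 5.4.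
-/

noncomputable section

open MeasureTheory ProbabilityTheory Filter Topology

namespace Summit.AtomisticToContinuum.HydrodynamicLimit.Theorems.MourreKoopmanChargesOneBodyCompleteness

open Literature.MathematicalPhysics.KineticTheory Literature.Analysis.FluidPDE
open Literature.Analysis.FunctionSpaces (PointConfig)
open Summit.AtomisticToContinuum.HydrodynamicLimit.Theorems.MourreKoopmanChargesStressStrongMixing
  (measurable_cov_comp_spatialShift abs_cov_comp_spatialShift_le integrable_cov_flow_spatialShift_of_decay
    cov_flow_zero_spatialShift cov_orbit_pair spatialShift_zero memLp_two_cellObs_of_isHardSphereGibbs)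

namespace DynamicClustering

variable {σ : ℝ}

/-! ### (ii) from mean-square continuity and locally uniform clustering (Doyon 2022 Thm 4.11 (III)) -/

/-- **Mean-square control of the truncated two-point function in its second argument**: on a probability space whose
shifts `τ_x` preserve `μ`, for `a, B₁, B₂ ∈ L²(μ)` and every `x`,
`|Cov_μ(a, B₁ ∘ τ_x) - Cov_μ(a, B₂ ∘ τ_x)| ≤ (Var a)^{1/2} · (∫ (B₁ - B₂)² dμ)^{1/2}`
(bilinearity, Cauchy–Schwarz, `Var ≤` second moment, shift invariance). [folklore] -/
theorem abs_cov_comp_spatialShift_sub_le {μ : Measure MarkedConfig} [IsProbabilityMeasure μ]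
    (hshift : ∀ x : V3, MeasurePreserving (spatialShift x) μ μ)
    {a B₁ B₂ : MarkedConfig → ℝ} (hB₁ : Measurable B₁) (hB₂ : Measurable B₂)
    (ha2 : MemLp a 2 μ) (hB₁2 : MemLp B₁ 2 μ) (hB₂2 : MemLp B₂ 2 μ) (x : V3) :
    |cov[a, B₁ ∘ spatialShift x; μ] - cov[a, B₂ ∘ spatialShift x; μ]| ≤
      Real.sqrt (Var[a; μ]) * Real.sqrt (∫ ω, (B₁ ω - B₂ ω) ^ 2 ∂μ) := by
  have h1x : MemLp (B₁ ∘ spatialShift x) 2 μ := hB₁2.comp_measurePreserving (hshift x)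
  have h2x : MemLp (B₂ ∘ spatialShift x) 2 μ := hB₂2.comp_measurePreserving (hshift x)
  have hsub : cov[a, B₁ ∘ spatialShift x; μ] - cov[a, B₂ ∘ spatialShift x; μ] =
      cov[a, (B₁ - B₂) ∘ spatialShift x; μ] := by
    rw [← covariance_sub_right ha2 h1x h2x]
    rfl
  have hD2 : MemLp (B₁ - B₂) 2 μ := hB₁2.sub hB₂2
  have hDx : MemLp ((B₁ - B₂) ∘ spatialShift x) 2 μ := hD2.comp_measurePreserving (hshift x)
  have hCS := Literature.Probability.Moments.covariance_sq_le_variance_mul ha2 hDx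
  have hvar : Var[(B₁ - B₂) ∘ spatialShift x; μ] = Var[B₁ - B₂; μ] := by
    rw [Function.comp_def]
    exact (hshift x).variance_fun_comp (hB₁.sub hB₂).aemeasurable
  have hvar2 : Var[B₁ - B₂; μ] ≤ ∫ ω, (B₁ ω - B₂ ω) ^ 2 ∂μ := by
    have h := variance_le_expectation_sq (μ := μ) hD2.aestronglyMeasurable
    simpa only [Pi.pow_apply, Pi.sub_apply] using h
  rw [hsub, ← Real.sqrt_sq_eq_abs, ← Real.sqrt_mul (variance_nonneg _ _)]
  exact Real.sqrt_le_sqrt (hCS.trans (hvar ▸ mul_le_mul_of_nonneg_left hvar2 (variance_nonneg _ _)))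

/-- **Pointwise-in-the-shift convergence of the two-time truncated two-point function from mean-square continuity of
the flow on the observable** (uniformly in `x`, in fact): for a flow `Φ` leaving the shift-invariant probability measure
`μ` invariant and `μ`-a.e. defined, `a ∈ L²(μ)`, measurable `b ∈ L²(μ)` with `∫ (b ∘ Φ_t - b)² dμ → 0` as `t → 0`,
`Cov_μ(a, (b ∘ Φ_t) ∘ τ_x) → Cov_μ(a, (b ∘ Φ_0) ∘ τ_x)` for every `x`. [cite: Doyon2022, §4.3 Thm 4.11 (III)] -/
theorem tendsto_cov_flow_spatialShift (Φ : InfiniteHardSphereFlow (Fin 3) σ) {μ : Measure MarkedConfig}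
    [IsProbabilityMeasure μ] (hS : Φ.IsStationary μ) (hD : Φ.IsAEDefined μ)
    (hshift : ∀ x : V3, MeasurePreserving (spatialShift x) μ μ)
    {a b : MarkedConfig → ℝ} (hb : Measurable b) (ha2 : MemLp a 2 μ) (hb2 : MemLp b 2 μ)
    (hL2 : Tendsto (fun t : ℝ => ∫ ω, (b (Φ.flow t ω) - b ω) ^ 2 ∂μ) (𝓝 0) (𝓝 0)) (x : V3) :
    Tendsto (fun t : ℝ => cov[a, (b ∘ Φ.flow t) ∘ spatialShift x; μ]) (𝓝 0)
      (𝓝 (cov[a, (b ∘ Φ.flow 0) ∘ spatialShift x; μ])) := by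
  rw [cov_flow_zero_spatialShift Φ hD hshift a b x]
  have hbt : ∀ t, MemLp (b ∘ Φ.flow t) 2 μ := fun t => hb2.comp_measurePreserving (hS.measurePreserving t)
  have hbound : ∀ t, |cov[a, (b ∘ Φ.flow t) ∘ spatialShift x; μ] - cov[a, b ∘ spatialShift x; μ]| ≤
      Real.sqrt (Var[a; μ]) * Real.sqrt (∫ ω, (b (Φ.flow t ω) - b ω) ^ 2 ∂μ) := fun t =>
    abs_cov_comp_spatialShift_sub_le hshift (hb.comp (Φ.measurable_flow t)) hb ha2 (hbt t) hb2 x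
  have hlim : Tendsto (fun t : ℝ => Real.sqrt (Var[a; μ]) * Real.sqrt (∫ ω, (b (Φ.flow t ω) - b ω) ^ 2 ∂μ))
      (𝓝 0) (𝓝 0) := by
    have h := (hL2.sqrt).const_mul (Real.sqrt (Var[a; μ]))
    rwa [Real.sqrt_zero, mul_zero] at h
  rw [tendsto_iff_norm_sub_tendsto_zero]
  exact squeeze_zero (fun t => norm_nonneg _) (fun t => by rw [Real.norm_eq_abs]; exact hbound t) hlim

/-- **Dynamical continuity from mean-square continuity and continuous clustering** (Doyon 2022 Thm 4.11 (III),
dominated convergence): for a flow `Φ` leaving the shift-invariant probability measure `μ` invariant and `μ`-a.e.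
defined, measurable `a, b ∈ L²(μ)`, if (1) `∫ (b ∘ Φ_t - b)² dμ → 0` as `t → 0` and (2) for `t` near `0` the two-time
truncated two-point function is dominated off one ball by one integrable function, `|Cov_μ(a, (b ∘ Φ_t) ∘ τ_x)| ≤ g(x)`
for `‖x‖ ≥ R`, then `t ↦ ∫ Cov_μ(a, (b ∘ Φ_t) ∘ τ_x) dx` is continuous at `t = 0` (inside the ball the integrand is
bounded by `(Var a · Var b)^{1/2}`, Cauchy–Schwarz and stationarity). [cite: Doyon2022, §4.3 Thm 4.11 (III)] -/
theorem continuousAt_integral_cov_flow_spatialShift (Φ : InfiniteHardSphereFlow (Fin 3) σ)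
    {μ : Measure MarkedConfig} [IsProbabilityMeasure μ] (hS : Φ.IsStationary μ) (hD : Φ.IsAEDefined μ)
    (hshift : ∀ x : V3, MeasurePreserving (spatialShift x) μ μ)
    {a b : MarkedConfig → ℝ} (ha : Measurable a) (hb : Measurable b) (ha2 : MemLp a 2 μ) (hb2 : MemLp b 2 μ)
    (hL2 : Tendsto (fun t : ℝ => ∫ ω, (b (Φ.flow t ω) - b ω) ^ 2 ∂μ) (𝓝 0) (𝓝 0))
    {g : V3 → ℝ} (hg : Integrable g volume) {R : ℝ}
    (hdom : ∀ᶠ t in 𝓝 (0 : ℝ), ∀ x : V3, R ≤ ‖x‖ → |cov[a, (b ∘ Φ.flow t) ∘ spatialShift x; μ]| ≤ g x) :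
    ContinuousAt (fun t : ℝ => ∫ x : V3, cov[a, (b ∘ Φ.flow t) ∘ spatialShift x; μ]) 0 := by
  set C : ℝ := Real.sqrt (Var[a; μ] * Var[b; μ]) with hC
  set bound : V3 → ℝ := fun x => (Metric.closedBall (0 : V3) R).indicator (fun _ => C) x + |g x| with hbound
  have hbt : ∀ t, MemLp (b ∘ Φ.flow t) 2 μ := fun t => hb2.comp_measurePreserving (hS.measurePreserving t)
  have hvar : ∀ t, Var[b ∘ Φ.flow t; μ] = Var[b; μ] := fun t => by
    rw [Function.comp_def]
    exact (hS.measurePreserving t).variance_fun_comp hb.aemeasurable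
  refine tendsto_integral_filter_of_dominated_convergence bound ?_ ?_ ?_ ?_
  · exact Eventually.of_forall fun t =>
      (measurable_cov_comp_spatialShift ha (hb.comp (Φ.measurable_flow t))).aestronglyMeasurable
  · filter_upwards [hdom] with t ht
    refine Eventually.of_forall fun x => ?_
    rw [Real.norm_eq_abs, hbound]
    dsimp only
    by_cases hx : x ∈ Metric.closedBall (0 : V3) R
    · rw [Set.indicator_of_mem hx]
      have h1 := abs_cov_comp_spatialShift_le hshift (hb.comp (Φ.measurable_flow t)) ha2 (hbt t) x
      rw [hvar t] at h1
      exact h1.trans (le_add_of_nonneg_right (abs_nonneg _))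
    · rw [Set.indicator_of_notMem hx, zero_add]
      have hxR : R ≤ ‖x‖ := by
        rw [Metric.mem_closedBall, dist_zero_right, not_le] at hx
        exact hx.le
      exact (ht x hxR).trans (le_abs_self _)
  · exact ((integrableOn_const (measure_closedBall_lt_top (x := (0 : V3)) (r := R)).ne).integrable_indicator
      Metric.isClosed_closedBall.measurableSet).add hg.abs
  · exact Eventually.of_forall fun x => tendsto_cov_flow_spatialShift Φ hS hD hshift hb ha2 hb2 hL2 x

/-! ### Mean-square continuity along the flow: two-sided from one-sided (stationarity + a.e. group law only) -/

/-- An even function of `t ∈ ℝ` converges along `𝓝 0` as soon as it converges along `𝓝[≥] 0`. [folklore] -/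
theorem tendsto_nhds_zero_of_even {β : Type*} {f : ℝ → β} (heven : ∀ t, f (-t) = f t) {l : Filter β}
    (h : Tendsto f (𝓝[≥] 0) l) : Tendsto f (𝓝 0) l := by
  have hneg : Tendsto (fun t : ℝ => -t) (𝓝[≤] (0 : ℝ)) (𝓝[≥] (0 : ℝ)) := by
    simpa only [neg_zero] using (tendsto_neg_nhdsLE (a := (0 : ℝ)))
  have h1 : Tendsto (f ∘ fun t : ℝ => -t) (𝓝[≤] (0 : ℝ)) l := h.comp hneg
  rw [show (f ∘ fun t : ℝ => -t) = f from funext fun t => heven t] at h1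
  simpa only [nhdsLE_sup_nhdsGE] using h1.sup h

/-- **Backward mean-square increments equal forward ones**: for a flow whose maps preserve `μ`, with `Φ_0 = id` a.e.
and the a.e. group law, and measurable `b`, `∫ (b ∘ Φ_{-t} - b)² dμ = ∫ (b ∘ Φ_t - b)² dμ` (change of variables
`ω ↦ Φ_t ω`; no commutation with the shifts is used). [folklore] -/
theorem integral_sq_sub_flow_neg (Φ : InfiniteHardSphereFlow (Fin 3) σ) {μ : Measure MarkedConfig}
    (hflow : ∀ t, MeasurePreserving (Φ.flow t) μ μ) (hzero : Φ.flow 0 =ᵐ[μ] id)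
    (hadd : ∀ s t : ℝ, Φ.flow (s + t) =ᵐ[μ] Φ.flow s ∘ Φ.flow t)
    {b : MarkedConfig → ℝ} (hb : Measurable b) (t : ℝ) :
    ∫ ω, (b (Φ.flow (-t) ω) - b ω) ^ 2 ∂μ = ∫ ω, (b (Φ.flow t ω) - b ω) ^ 2 ∂μ := by
  have hmeas : Measurable fun ω => (b (Φ.flow (-t) ω) - b ω) ^ 2 :=
    ((hb.comp (Φ.measurable_flow (-t))).sub hb).pow_const 2
  have h1 := integral_map (μ := μ) (Φ.measurable_flow t).aemeasurable (f := fun ω => (b (Φ.flow (-t) ω) - b ω) ^ 2)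
    hmeas.aestronglyMeasurable
  rw [(hflow t).map_eq] at h1
  rw [h1]
  have g := hadd (-t) t
  rw [neg_add_cancel] at g
  refine integral_congr_ae ?_
  filter_upwards [g, hzero] with ω hω hω0
  rw [Function.comp_apply] at hω
  rw [← hω, hω0, id]
  ring

/-- **Two-sided mean-square continuity at `t = 0` from right mean-square continuity**: same setting. [folklore] -/
theorem tendsto_integral_sq_sub_flow_of_Ici (Φ : InfiniteHardSphereFlow (Fin 3) σ) {μ : Measure MarkedConfig}
    (hflow : ∀ t, MeasurePreserving (Φ.flow t) μ μ) (hzero : Φ.flow 0 =ᵐ[μ] id)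
    (hadd : ∀ s t : ℝ, Φ.flow (s + t) =ᵐ[μ] Φ.flow s ∘ Φ.flow t)
    {b : MarkedConfig → ℝ} (hb : Measurable b)
    (h : Tendsto (fun t : ℝ => ∫ ω, (b (Φ.flow t ω) - b ω) ^ 2 ∂μ) (𝓝[≥] 0) (𝓝 0)) :
    Tendsto (fun t : ℝ => ∫ ω, (b (Φ.flow t ω) - b ω) ^ 2 ∂μ) (𝓝 0) (𝓝 0) :=
  tendsto_nhds_zero_of_even (fun t => integral_sq_sub_flow_neg Φ hflow hzero hadd hb t) h

/-! ### Time reversal of the two-time truncated two-point function (stationarity + a.e. shift covariance) -/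

section TimeReversal

variable (Φ : InfiniteHardSphereFlow (Fin 3) σ) {μ : Measure MarkedConfig}
  (hflow : ∀ t, MeasurePreserving (Φ.flow t) μ μ) (hshift : ∀ x : V3, MeasurePreserving (spatialShift x) μ μ)
  (hzero : Φ.flow 0 =ᵐ[μ] id) (hadd : ∀ s t : ℝ, Φ.flow (s + t) =ᵐ[μ] Φ.flow s ∘ Φ.flow t)
  (hcomm : ∀ (t : ℝ) (x : V3), Φ.flow t ∘ spatialShift x =ᵐ[μ] spatialShift x ∘ Φ.flow t)
include hflow hshift hzero hadd hcomm

/-- **Time reversal**: for a flow `Φ` whose maps preserve the shift-invariant measure `μ`, with `Φ_0 = id` a.e., the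
a.e. group law and a.e. commutation with the shifts, and `a, b ∈ L²(μ)`,
`Cov_μ(a, (b ∘ Φ_{-t}) ∘ τ_x) = Cov_μ(b, (a ∘ Φ_t) ∘ τ_{-x})` (twice the sibling `cov_orbit_pair`). [folklore] -/
theorem cov_flow_neg_spatialShift {a b : MarkedConfig → ℝ} (ha2 : MemLp a 2 μ) (hb2 : MemLp b 2 μ) (t : ℝ) (x : V3) :
    cov[a, (b ∘ Φ.flow (-t)) ∘ spatialShift x; μ] = cov[b, (a ∘ Φ.flow t) ∘ spatialShift (-x); μ] := by
  have hb0 : b ∘ Φ.flow 0 ∘ spatialShift 0 =ᵐ[μ] b := by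
    simpa only [spatialShift_zero, Function.comp_id] using hzero.fun_comp b
  have ha0 : a ∘ Φ.flow t ∘ spatialShift 0 = a ∘ Φ.flow t := by rw [spatialShift_zero, Function.comp_id]
  -- `Cov(a, (b ∘ Φ_{-t}) ∘ τ_x) = Cov(a ∘ Φ_t, b ∘ τ_x)`
  have h1 := cov_orbit_pair Φ μ hflow hshift hadd hcomm ha2 hb2 t 0 0 0 x
  rw [zero_sub, zero_add, sub_zero, ha0] at h1
  have h1' : cov[a ∘ Φ.flow t, (b ∘ Φ.flow 0 ∘ spatialShift 0) ∘ spatialShift x; μ] =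
      cov[a ∘ Φ.flow t, b ∘ spatialShift x; μ] :=
    covariance_congr_ae EventuallyEq.rfl ((hshift x).quasiMeasurePreserving.ae_eq_comp hb0)
  -- `Cov(b ∘ τ_x, a ∘ Φ_t) = Cov(b, (a ∘ Φ_t) ∘ τ_{-x})`
  have h2 := cov_orbit_pair Φ μ hflow hshift hadd hcomm hb2 ha2 0 t x 0 0
  rw [sub_zero, zero_add, zero_sub, ha0] at h2
  have h2' : cov[b ∘ Φ.flow 0 ∘ spatialShift x, (a ∘ Φ.flow t) ∘ spatialShift 0; μ] =
      cov[b ∘ spatialShift x, a ∘ Φ.flow t; μ] := by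
    rw [spatialShift_zero, Function.comp_id]
    refine covariance_congr_ae ?_ EventuallyEq.rfl
    exact (hshift x).quasiMeasurePreserving.ae_eq_comp (hzero.fun_comp b)
  rw [← h1, h1', covariance_comm, ← h2', h2]

/-- **Time reversal of spatial clustering**: same setting; `x ↦ Cov_μ(a, (b ∘ Φ_{-t}) ∘ τ_x)` is integrable on `ℝ³` iff
`x ↦ Cov_μ(b, (a ∘ Φ_t) ∘ τ_x)` is (reflection invariance of Lebesgue measure). [folklore] -/
theorem integrable_cov_flow_neg_spatialShift_iff {a b : MarkedConfig → ℝ} (ha2 : MemLp a 2 μ) (hb2 : MemLp b 2 μ)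
    (t : ℝ) :
    Integrable (fun x : V3 => cov[a, (b ∘ Φ.flow (-t)) ∘ spatialShift x; μ]) volume ↔
      Integrable (fun x : V3 => cov[b, (a ∘ Φ.flow t) ∘ spatialShift x; μ]) volume := by
  have e : (fun x : V3 => cov[a, (b ∘ Φ.flow (-t)) ∘ spatialShift x; μ]) =
      (fun x : V3 => cov[b, (a ∘ Φ.flow t) ∘ spatialShift x; μ]) ∘ Neg.neg :=
    funext fun x => cov_flow_neg_spatialShift Φ hflow hshift hzero hadd hcomm ha2 hb2 t x
  rw [e]
  exact (Measure.measurePreserving_neg (volume : Measure V3)).integrable_comp_emb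
    (MeasurableEquiv.neg V3).measurableEmbedding

/-- **Time reversal of the space-integrated two-time correlation**: same setting;
`∫ Cov_μ(a, (b ∘ Φ_{-t}) ∘ τ_x) dx = ∫ Cov_μ(b, (a ∘ Φ_t) ∘ τ_x) dx`; in particular the space-integrated AUTOcorrelation
`t ↦ ∫ Cov_μ(b, (b ∘ Φ_t) ∘ τ_x) dx` is an even function of `t`. [folklore] -/
theorem integral_cov_flow_neg_spatialShift {a b : MarkedConfig → ℝ} (ha2 : MemLp a 2 μ) (hb2 : MemLp b 2 μ) (t : ℝ) :
    ∫ x : V3, cov[a, (b ∘ Φ.flow (-t)) ∘ spatialShift x; μ] =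
      ∫ x : V3, cov[b, (a ∘ Φ.flow t) ∘ spatialShift x; μ] := by
  have e : (fun x : V3 => cov[a, (b ∘ Φ.flow (-t)) ∘ spatialShift x; μ]) =
      fun x : V3 => cov[b, (a ∘ Φ.flow t) ∘ spatialShift (-x); μ] :=
    funext fun x => cov_flow_neg_spatialShift Φ hflow hshift hzero hadd hcomm ha2 hb2 t x
  rw [e]
  exact integral_neg_eq_self (fun x : V3 => cov[b, (a ∘ Φ.flow t) ∘ spatialShift x; μ]) volume

/-- **Two-time clustering at all times from non-negative times**: same setting, for a family `S ⊆ L²(μ)`: if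
`x ↦ Cov_μ(a, (b ∘ Φ_t) ∘ τ_x)` is integrable for all `a, b ∈ S` and all `t ≥ 0`, then for all `a, b ∈ S` and ALL
`t`. [folklore] -/
theorem integrable_cov_flow_spatialShift_of_nonneg {S : Set (MarkedConfig → ℝ)} (hS2 : ∀ a ∈ S, MemLp a 2 μ)
    (h : ∀ a ∈ S, ∀ b ∈ S, ∀ t : ℝ, 0 ≤ t →
      Integrable (fun x : V3 => cov[a, (b ∘ Φ.flow t) ∘ spatialShift x; μ]) volume) :
    ∀ a ∈ S, ∀ b ∈ S, ∀ t : ℝ, Integrable (fun x : V3 => cov[a, (b ∘ Φ.flow t) ∘ spatialShift x; μ]) volume := by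
  intro a ha b hb t
  rcases le_or_gt 0 t with ht | ht
  · exact h a ha b hb t ht
  · have h' := h b hb a ha (-t) (neg_nonneg.2 ht.le)
    rw [← integrable_cov_flow_neg_spatialShift_iff Φ hflow hshift hzero hadd hcomm (hS2 a ha) (hS2 b hb) (-t),
      neg_neg] at h'
    exact h'

/-- **Two-sided dynamical continuity from right continuity**: same setting; for `b ∈ L²(μ)` the space-integrated
autocorrelation `C_b(t) = ∫ Cov_μ(b, (b ∘ Φ_t) ∘ τ_x) dx` is even, so it is continuous at `0` as soon as it is right
continuous at `0`. [folklore] -/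
theorem continuousAt_integral_cov_of_continuousWithinAt_Ici {b : MarkedConfig → ℝ} (hb2 : MemLp b 2 μ)
    (h : ContinuousWithinAt (fun t : ℝ => ∫ x : V3, cov[b, (b ∘ Φ.flow t) ∘ spatialShift x; μ]) (Set.Ici 0) 0) :
    ContinuousAt (fun t : ℝ => ∫ x : V3, cov[b, (b ∘ Φ.flow t) ∘ spatialShift x; μ]) 0 :=
  tendsto_nhds_zero_of_even (fun t => integral_cov_flow_neg_spatialShift Φ hflow hshift hzero hadd hcomm hb2 hb2 t)
    h.tendsto

end TimeReversal

/-! ### The six one-body generators `S_g = {n_0, …, n_4, A_g}` -/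

/-- Every generator `a ∈ S_g` (continuous polynomially bounded profile `g`) is a one-body cell observable `A_h` of a
continuous polynomially bounded `h` (`n_i = A_{e_i}`, `|e_i(v)| ≤ (1 + ‖v‖)²`). [folklore] -/
theorem exists_eq_cellObs_of_mem_oneBodyGenerators {g : V3 → ℝ} (hg : Continuous g)
    (hgb : ∃ (C : ℝ) (k : ℕ), ∀ v, |g v| ≤ C * (1 + ‖v‖) ^ k) {a : MarkedConfig → ℝ}
    (ha : a ∈ Set.range cellCharge ∪ {cellObs g}) :
    ∃ h : V3 → ℝ, Continuous h ∧ (∃ (C : ℝ) (k : ℕ), ∀ v, |h v| ≤ C * (1 + ‖v‖) ^ k) ∧ a = cellObs h := by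
  rcases ha with ⟨i, rfl⟩ | ha
  · exact ⟨chargeFn i, continuous_chargeFn i, ⟨1, 2, fun v => by simpa only [one_mul] using abs_chargeFn_le i v⟩, rfl⟩
  · exact ⟨g, hg, hgb, Set.mem_singleton_iff.1 ha⟩

/-- The six generators are measurable. [folklore] -/
theorem measurable_of_mem_oneBodyGenerators {g : V3 → ℝ} (hg : Continuous g) :
    ∀ a ∈ Set.range cellCharge ∪ {cellObs g}, Measurable a := by
  rintro a (⟨i, rfl⟩ | ha)
  · exact measurable_cellCharge i
  · rw [Set.mem_singleton_iff.1 ha]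
    exact measurable_cellObs hg.measurable

/-- The six generators are square integrable under every DLR state of unit hard spheres at unit inverse temperature
(`memLp_two_cellObs_of_isHardSphereGibbs`). [folklore] -/
theorem memLp_of_mem_oneBodyGenerators {z : ℝ} (hz : 0 < z) {G : Measure MarkedConfig}
    (hG : IsHardSphereGibbs 1 z 1 (0 : V3) G) {g : V3 → ℝ} (hg : Continuous g)
    (hgb : ∃ (C : ℝ) (k : ℕ), ∀ v, |g v| ≤ C * (1 + ‖v‖) ^ k) :
    ∀ a ∈ Set.range cellCharge ∪ {cellObs g}, MemLp a 2 G := by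
  have hG' : IsHardSphereGibbs 1 z (1 : ℝ)⁻¹ (0 : V3) G := by rw [inv_one]; exact hG
  intro a ha
  obtain ⟨h, hh, ⟨C, k, hC⟩, rfl⟩ := exists_eq_cellObs_of_mem_oneBodyGenerators hg hgb ha
  exact memLp_two_cellObs_of_isHardSphereGibbs hz.le one_pos hG' hh.measurable hC

end DynamicClustering

open DynamicClustering

/-! ### The registered signature from the two named inputs (D1), (D2) -/

/-- **Reduction of the registered stub `stub_dynamicClusteringOneBody` to Doyon's two hypotheses.**  The registered
signature (two-time spatial clustering of the six generators at every time + continuity at `t = 0` of their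
space-integrated autocorrelations, under every unit-diameter equilibrium flow and every dilute translation-invariant
unit-temperature DLR state, given static clustering) follows VERBATIM from
(D1) CONTINUOUS CLUSTERING (Doyon 2022 Def. 4.8; Spohn 1991 Part I §7.1: the open, in print ASSUMED, content) — an
integrable majorant of `|Cov_G(a, (b ∘ Φ_t) ∘ τ_x)|` off a ball, uniform in `|t| ≤ T`, for all generators `a, b` and
every `T` — and
(D2) RIGHT MEAN-SQUARE CONTINUITY at `t = 0` of `t ↦ A_h ∘ Φ_t` in `L²(G)` for continuous polynomially bounded `h`
(strong continuity on the GNS space; for Alexander's flow a consequence of the regularity of his solutions, Def. 4.8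
(b), absent from the `InfiniteHardSphereFlow` structure):
(i) by `integrable_cov_flow_spatialShift_of_decay` with `T = |t|`; (ii) by `continuousAt_integral_cov_flow_spatialShift`
with the majorant of `T = 1` and `tendsto_integral_sq_sub_flow_of_Ici`. [cite: Doyon2022, §4.3 Thm 4.11 (III)] -/
theorem dynamicClusteringOneBody_of :
    (∃ z₄ : ℝ, 0 < z₄ ∧ ∀ Φ : InfiniteHardSphereFlow (Fin 3) 1, Φ.IsEquilibriumFlow →
      ∀ z : ℝ, 0 < z → z < z₄ → ∀ G : Measure MarkedConfig, IsHardSphereGibbs 1 z 1 (0 : V3) G →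
        IsTranslationInvariant G →
        ∀ g : V3 → ℝ, Continuous g → (∃ (C : ℝ) (k : ℕ), ∀ v, |g v| ≤ C * (1 + ‖v‖) ^ k) →
          (∫ v, g v * localMaxwellian 1 1 (0 : V3) v = 0) →
          (∀ a ∈ Set.range cellCharge ∪ {cellObs g}, ∀ b ∈ Set.range cellCharge ∪ {cellObs g},
              Integrable (fun x : V3 => cov[a, b ∘ spatialShift x; G]) volume) →
          ∀ a ∈ Set.range cellCharge ∪ {cellObs g}, ∀ b ∈ Set.range cellCharge ∪ {cellObs g}, ∀ T : ℝ,
            ∃ F : V3 → ℝ, Integrable F volume ∧ ∃ R : ℝ, ∀ t : ℝ, |t| ≤ T →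
              ∀ x : V3, R ≤ ‖x‖ → |cov[a, (b ∘ Φ.flow t) ∘ spatialShift x; G]| ≤ F x) →
    (∀ Φ : InfiniteHardSphereFlow (Fin 3) 1, Φ.IsEquilibriumFlow → ∀ z : ℝ, 0 < z →
      ∀ G : Measure MarkedConfig, IsHardSphereGibbs 1 z 1 (0 : V3) G →
        ∀ h : V3 → ℝ, Continuous h → (∃ (C : ℝ) (k : ℕ), ∀ v, |h v| ≤ C * (1 + ‖v‖) ^ k) →
          Tendsto (fun t : ℝ => ∫ ω, (cellObs h (Φ.flow t ω) - cellObs h ω) ^ 2 ∂G) (𝓝[≥] 0) (𝓝 0)) →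
    ∃ z₄ : ℝ, 0 < z₄ ∧ ∀ Φ : InfiniteHardSphereFlow (Fin 3) 1, Φ.IsEquilibriumFlow →
      ∀ z : ℝ, 0 < z → z < z₄ → ∀ G : Measure MarkedConfig, IsHardSphereGibbs 1 z 1 (0 : V3) G →
        IsTranslationInvariant G →
        ∀ g : V3 → ℝ, Continuous g → (∃ (C : ℝ) (k : ℕ), ∀ v, |g v| ≤ C * (1 + ‖v‖) ^ k) →
          (∫ v, g v * localMaxwellian 1 1 (0 : V3) v = 0) →
          (∀ a ∈ Set.range cellCharge ∪ {cellObs g}, ∀ b ∈ Set.range cellCharge ∪ {cellObs g},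
              Integrable (fun x : V3 => cov[a, b ∘ spatialShift x; G]) volume) →
          (∀ a ∈ Set.range cellCharge ∪ {cellObs g}, ∀ b ∈ Set.range cellCharge ∪ {cellObs g}, ∀ t : ℝ,
              Integrable (fun x : V3 => cov[a, (b ∘ Φ.flow t) ∘ spatialShift x; G]) volume) ∧
          (∀ b ∈ Set.range cellCharge ∪ {cellObs g},
              ContinuousAt (fun t : ℝ => ∫ x : V3, cov[b, (b ∘ Φ.flow t) ∘ spatialShift x; G]) 0) := by
  rintro ⟨z₄, hz₄, H⟩ hD2
  refine ⟨z₄, hz₄, fun Φ hΦ z hz hz4 G hG hti g hg hgb hg0 hst => ?_⟩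
  haveI : IsProbabilityMeasure G := hG.1
  have hD : Φ.IsAEDefined G := (hΦ z 1 hz one_pos G hG).1
  have hS : Φ.IsStationary G := (hΦ z 1 hz one_pos G hG).2
  have hshift : ∀ x : V3, MeasurePreserving (spatialShift x) G G := fun x =>
    ⟨PointConfig.measurable_translate _, hti x⟩
  have hflow : ∀ t, MeasurePreserving (Φ.flow t) G G := hS.measurePreserving
  have hzero : Φ.flow 0 =ᵐ[G] id := Φ.flow_zero_ae hD
  have hadd : ∀ s t : ℝ, Φ.flow (s + t) =ᵐ[G] Φ.flow s ∘ Φ.flow t := fun s t => Φ.flow_add_ae hD hS s t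
  have hmeas := measurable_of_mem_oneBodyGenerators hg
  have hL2 := memLp_of_mem_oneBodyGenerators hz hG hg hgb
  have Hd := H Φ hΦ z hz hz4 G hG hti g hg hgb hg0 hst
  refine ⟨fun a ha b hb t => ?_, fun b hb => ?_⟩
  · -- (i): the majorant of (D1) with `T = |t|` and the sibling decay reduction
    obtain ⟨F, hF, R, hR⟩ := Hd a ha b hb |t|
    exact integrable_cov_flow_spatialShift_of_decay Φ hS hshift (hmeas a ha) (hmeas b hb) (hL2 a ha) (hL2 b hb) t hF
      (fun x hx => hR t le_rfl x hx)
  · -- (ii): Doyon's criterion with the majorant of (D1) for `|t| ≤ 1` and the mean-square continuity (D2)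
    obtain ⟨F, hF, R, hR⟩ := Hd b hb b hb 1
    obtain ⟨h, hh, hhb, rfl⟩ := exists_eq_cellObs_of_mem_oneBodyGenerators hg hgb hb
    have hms : Tendsto (fun t : ℝ => ∫ ω, (cellObs h (Φ.flow t ω) - cellObs h ω) ^ 2 ∂G) (𝓝 0) (𝓝 0) :=
      tendsto_integral_sq_sub_flow_of_Ici Φ hflow hzero hadd (hmeas _ hb) (hD2 Φ hΦ z hz G hG h hh hhb)
    refine continuousAt_integral_cov_flow_spatialShift Φ hS hD hshift (hmeas _ hb) (hmeas _ hb) (hL2 _ hb) (hL2 _ hb)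
      hms hF (R := R) ?_
    filter_upwards [Icc_mem_nhds (show (-1 : ℝ) < 0 by norm_num) (show (0 : ℝ) < 1 by norm_num)] with t ht
    exact hR t (abs_le.2 ⟨ht.1, ht.2⟩)

end Summit.AtomisticToContinuum.HydrodynamicLimit.Theorems.MourreKoopmanChargesOneBodyCompleteness

end
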